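import Literature.Barriers.ValiantsHypothesis.FSV18UniversalConstructions
import Mathlib.Algebra.CharP.Basic
import Mathlib.Algebra.MvPolynomial.CommRing
import HarnessLib

/-!
# [ASSS16, §4 ¶1]: a non-constant polynomial has a non-zero unit difference
# `C(…, x_i + 1, …) − C` (characteristic `0` or larger than the degree) — val-lit p1 g3

Source: Agrawal–Saha–Saptharishi–Saxena, *Jacobian hits circuits*, arXiv:1111.0582, §4 ¶1 (held
`paper:arxiv-1111.0582` p0009:L3–L8): "Observe that if `C(x_1, …, x_n)` is non-constant and nonzero,
then there is an `i` such that `C̃ := C(x_1, ⋯, x_{i-1}, x_i + 1, x_{i+1}, ⋯, x_n) − C(x_1, ⋯, x_n) ≠ 0`,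
assuming `char(𝔽) > s^D` (i.e. the bound on the degree of `C`)." Bib key `AgrawalEtAl2011`.

The printed claim, PROVED over every field in the form «`char 𝔽 = 0` or `char 𝔽 > deg C`»
(`ASSS16.exists_shift_sub_ne_zero`), by the evaluation route: if every unit shift fixes `C` then
`C` takes the value `C(0)` at every point of `ℕ^σ`, hence `C − C(0)` vanishes on the grid
`{0, …, deg C}^σ` — `deg C + 1` DISTINCT field elements under the characteristic hypothesis — and
is `0` by interpolation (FSV Lemma 14's `exists_eval_ne_zero_of_totalDegree_lt`). This is the
class-independent half of the shift step in the N1 plan HOME/np/p1g3-THM48-provenance-and-plan.md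
(the generator half is `FSV18GeneratorShiftUpgrade.lean`). Theorems only. Honest framing:
`VP ≠ VNP` is NOT proved and nothing here bears on it.
-/

noncomputable section

namespace Literature.Computability.AlgebraicComplexity

namespace ASSS16

open MvPolynomial Finset

variable {F : Type*} [Field F] {σ : Type*} [Fintype σ] [DecidableEq σ]

omit [Fintype σ] in
/-- Evaluating the unit shift `X_{m₀} ↦ X_{m₀} + c`: `(C(X_{m₀} ↦ X_{m₀}+c))(x) = C(x + c·e_{m₀})`.
[folklore] -/
private theorem eval_aeval_unitShift (x : σ → F) (m₀ : σ) (c : F) (C₀ : MvPolynomial σ F) :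
    eval x (aeval (fun m : σ => if m = m₀ then X m + C c else (X m : MvPolynomial σ F)) C₀) =
      eval (Function.update x m₀ (x m₀ + c)) C₀ := by
  rw [aeval_eq_bind₁]
  have h : eval x (bind₁ (fun m : σ => if m = m₀ then X m + C c else (X m : MvPolynomial σ F)) C₀) =
      eval (fun m => eval x (if m = m₀ then X m + C c else (X m : MvPolynomial σ F))) C₀ :=
    eval₂Hom_bind₁ _ _ _ _
  rw [h]
  refine congrArg (fun y => eval y C₀) (funext fun m => ?_)
  by_cases hm : m = m₀
  · subst hm
    simp
  · simp [hm]

/-- If every unit shift fixes `C`, then `C` takes the value `C(0)` at every lattice point of `ℕ^σ`.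
[folklore] -/
private theorem eval_natCast_eq_of_forall_shift (C₀ : MvPolynomial σ F)
    (hall : ∀ m₀ : σ,
      aeval (fun m : σ => if m = m₀ then X m + C 1 else (X m : MvPolynomial σ F)) C₀ = C₀) :
    ∀ (N : ℕ) (a : σ → ℕ), ∑ m, a m = N →
      eval (fun m => (a m : F)) C₀ = eval (fun _ => (0 : F)) C₀ := by
  intro N
  induction N with
  | zero =>
    intro a ha
    have ha0 : ∀ m, a m = 0 := fun m => (Finset.sum_eq_zero_iff.1 ha) m (Finset.mem_univ m)
    have : (fun m => (a m : F)) = fun _ => (0 : F) := funext fun m => by simp [ha0 m]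
    rw [this]
  | succ N ih =>
    intro a ha
    obtain ⟨m₁, hm₁⟩ : ∃ m, a m ≠ 0 := by
      by_contra h
      push Not at h
      rw [Finset.sum_eq_zero fun m _ => h m] at ha
      exact Nat.succ_ne_zero N ha.symm
    set a' : σ → ℕ := Function.update a m₁ (a m₁ - 1) with ha'def
    have hsum' : ∑ m, a' m = N := by
      have h1 : ∑ m, a' m + 1 = ∑ m, a m := by
        rw [ha'def, Finset.sum_update_of_mem (Finset.mem_univ m₁), ← Finset.add_sum_erase _ _ (Finset.mem_univ m₁)]
        have : Finset.univ \ {m₁} = Finset.univ.erase m₁ := by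
          ext m
          simp
        rw [this]
        omega
      omega
    have hx : (fun m => (a m : F)) = Function.update (fun m => (a' m : F)) m₁ ((a' m₁ : F) + 1) := by
      funext m
      by_cases h : m = m₁
      · subst h
        rw [Function.update_self, ha'def, Function.update_self]
        have : a m = (a m - 1) + 1 := by omega
        conv_lhs => rw [this]
        push_cast
        ring
      · rw [Function.update_of_ne h, ha'def, Function.update_of_ne h]
    rw [hx, ← eval_aeval_unitShift (fun m => (a' m : F)) m₁ 1 C₀, hall m₁]
    exact ih a' hsum'

/-- **[ASSS16, §4 ¶1]:** "if `C(x_1, …, x_n)` is non-constant and nonzero, then there is an `i` such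
that `C̃ := C(x_1, ⋯, x_i + 1, ⋯, x_n) − C(x_1, ⋯, x_n) ≠ 0`, assuming `char(𝔽)` [exceeds] the
degree of `C`" — typed for `C` of positive total degree over a field with `char 𝔽 = 0` or
`deg C < char 𝔽`, unit shift = the substitution `X_{m₀} ↦ X_{m₀} + 1`.
[cite: AgrawalEtAl2011, §4 (¶1)] locator: paper:arxiv-1111.0582 p0009.txt:L3–L8 -/
theorem exists_shift_sub_ne_zero (C₀ : MvPolynomial σ F) (hC : C₀.totalDegree ≠ 0)
    (hchar : ringChar F = 0 ∨ C₀.totalDegree < ringChar F) :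
    ∃ m₀ : σ, aeval (fun m : σ => if m = m₀ then X m + C 1 else (X m : MvPolynomial σ F)) C₀ - C₀ ≠ 0 := by
  classical
  by_contra hnot
  push Not at hnot
  have hall : ∀ m₀ : σ,
      aeval (fun m : σ => if m = m₀ then X m + C 1 else (X m : MvPolynomial σ F)) C₀ = C₀ :=
    fun m₀ => sub_eq_zero.1 (hnot m₀)
  set T := C₀.totalDegree with hT
  -- `Q = C − C(0)` vanishes on the lattice points
  set Q : MvPolynomial σ F := C₀ - C (eval (fun _ => (0 : F)) C₀) with hQ
  have hQT : Q.totalDegree ≤ T := by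
    refine (totalDegree_sub _ _).trans (max_le le_rfl ?_)
    rw [totalDegree_C]
    exact Nat.zero_le _
  have hQeval : ∀ a : σ → ℕ, eval (fun m => (a m : F)) Q = 0 := by
    intro a
    rw [hQ, map_sub, eval_C, eval_natCast_eq_of_forall_shift C₀ hall _ a rfl, sub_self]
  -- the grid `{0, …, T}^σ` of `T + 1` distinct field elements
  set S : Finset F := (Finset.range (T + 1)).image (fun i : ℕ => (i : F)) with hS
  have hSinj : Set.InjOn (fun i : ℕ => (i : F)) (Finset.range (T + 1) : Set ℕ) := by
    intro i hi j hj hij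
    have hmod := (CharP.natCast_eq_natCast F (ringChar F)).1 hij
    rcases hchar with h0 | hlt
    · rw [h0] at hmod
      exact Nat.modEq_zero_iff.1 hmod
    · have hi' : i < ringChar F := lt_of_lt_of_le (Finset.mem_range.1 hi) hlt
      have hj' : j < ringChar F := lt_of_lt_of_le (Finset.mem_range.1 hj) hlt
      exact hmod.eq_of_lt_of_lt hi' hj'
  have hScard : S.card = T + 1 := by
    rw [hS, Finset.card_image_of_injOn hSinj, Finset.card_range]
  -- interpolation: `Q = 0`
  have hQ0 : Q = 0 := by
    by_contra hne
    set e := Fintype.equivFin σ with he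
    have hQ' : rename e Q ≠ 0 := fun h => hne (rename_injective _ e.injective (by rw [h, map_zero]))
    have hdeg : (rename e Q).totalDegree < S.card := by
      rw [hScard]
      exact lt_of_le_of_lt ((totalDegree_rename_le _ _).trans hQT) (Nat.lt_succ_self _)
    obtain ⟨b, hbS, hb⟩ :=
      Literature.Barriers.ValiantsHypothesis.FSV2018.exists_eval_ne_zero_of_totalDegree_lt hQ' S hdeg
    apply hb
    rw [eval_rename]
    have hex : ∀ m : σ, ∃ i : ℕ, (i : F) = (b ∘ e) m := by
      intro m
      obtain ⟨i, -, hi⟩ := Finset.mem_image.1 (hbS (e m))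
      exact ⟨i, hi⟩
    choose a ha using hex
    have hfun : (b ∘ e) = fun m => (a m : F) := funext fun m => (ha m).symm
    rw [hfun]
    exact hQeval a
  have hconst : C₀ = C (eval (fun _ => (0 : F)) C₀) := sub_eq_zero.1 hQ0
  have h2 := congrArg totalDegree hconst
  rw [totalDegree_C] at h2
  exact hC h2

end ASSS16

end Literature.Computability.AlgebraicComplexity

end
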